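import Summits.CriticalPhenomena.SAWScalingLimit.Theorems.SAWDefectDecoherenceObservableToSLERModulusOfSimpleLimits
import Literature.Probability.RandomPlanarGeometry.PolylineShellTraversals
import HarnessLib

/-!
# No macroscopic backtracking of the critical hexagonal SAW from tightness and simple limits

Stub `stub_noMacroBacktracking` (line `six-class-type-ladder`, skeleton r14) of the crux
`Summit.CriticalPhenomena.SAWScalingLimit.Theses.SAWDevelopingMap.ObservableToSLE`
(item `stmt-CriticalPhenomena-10472`): TIGHTNESS along the mesh (hypothesis 1, `HexTight` inlined)
and SIMPLICITY OF ALL SUBSEQUENTIAL LIMITS with the correct end points (hypothesis 2, item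
stmt-CriticalPhenomena-7148 inlined) imply NO MACROSCOPIC BACKTRACKING: for all `R' > 0`, `ε > 0`
some `r > 0` makes, eventually in `δ`, the lattice events "a vertex at distance `≥ R'` from `pt 0`
and LATER a vertex within `r` of `pt 0`" and "a vertex within `r` of `pt 1` and LATER a vertex at
distance `≥ R'` from `pt 1`" of `hexSAWLaw`-mass `≤ ε` each.  Pattern of
`Modulus.stub_hexUniformModulus_of_simpleLimits`: the CLOSED, representative-independent curve
events `visitsThen A B` (`isClosed_visitsThen`, `mk_mem_visitsThen_iff`), their nullity in the limit
on simple classes with the correct end points (`not_mem_iInter_visitsThen_of_source` / `_of_target`),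
the lattice-to-curve dictionary by vertex times of the polyline (`curve_mem_visitsThen`), and the
Prokhorov/portmanteau contradiction (`exists_eventually_measure_le_of_antitone`).
-/

noncomputable section

open scoped BigOperators Topology NNReal ENNReal Classical BoundedContinuousFunction
open Filter Set MeasureTheory Metric
open Literature.Probability.LatticeModels (HexVertex hexGraph hexCenter polyline)
open Literature.Probability.RandomPlanarGeometry
open Literature.Probability.RandomPlanarGeometry.SAW

namespace Summit.CriticalPhenomena.SAWScalingLimit.Theorems.ObservableToSLE.TypeLadder

open Summit.CriticalPhenomena.SAWScalingLimit.Theorems.ObservableToSLE.Negative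
  (eventually_isProbabilityMeasure_hexSAWLaw)

/-! ### The closed events "visit `A`, then `B`" in curve space -/

section VisitsThen

variable {E : Type*} [MetricSpace E]

/-! The event `visitsThen A B` of this file is the image
`CurveClass.mk '' {γ | ∃ s t, s ≤ t ∧ γ s ∈ A ∧ γ t ∈ B}`: the curve classes having a representative
that visits `A` at some time `s` and `B` at some later time `t ≥ s` (written out, no definition). -/

/-- **Transfer to a nearby curve, with a loss**: if `γ` visits `A` then `B` and `dist γ' γ < c`,
then `γ'` visits the `c`-neighbourhood of a point of `A` and then that of a point of `B`. -/
theorem exists_near_of_dist_lt {A B : Set E} {γ γ' : Curve E} {c : ℝ}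
    (h : ∃ s t : unitInterval, s ≤ t ∧ γ s ∈ A ∧ γ t ∈ B) (hd : dist γ' γ < c) :
    ∃ s t : unitInterval, s ≤ t ∧ ∃ x ∈ A, ∃ y ∈ B, dist (γ' s) x ≤ c ∧ dist (γ' t) y ≤ c := by
  obtain ⟨s, t, hst, hs, ht⟩ := h
  obtain ⟨φ, hφ⟩ := Curve.exists_dist_reparam_lt hd
  have hpt : ∀ r, dist (γ' r) (γ (φ r)) < c := fun r =>
    (ContinuousMap.dist_apply_le_dist (f := γ'.toContinuousMap)
      (g := (γ.reparam φ).toContinuousMap) r).trans_lt hφ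
  refine ⟨φ.symm s, φ.symm t, φ.symm.monotone hst, γ s, hs, γ t, ht, ?_, ?_⟩
  · simpa using (hpt (φ.symm s)).le
  · simpa using (hpt (φ.symm t)).le

/-- **Closure under approximate visits**: if along a null sequence `η n` the curve `γ` visits the
`η n`-neighbourhood of a point of the closed set `A` and then that of a point of the closed set `B`,
then `γ` visits `A` and then `B` (subsequence of the pairs of times in the compact `unitInterval²`). -/
theorem exists_le_mem_of_forall_near {A B : Set E} (hA : IsClosed A) (hB : IsClosed B)
    {γ : Curve E} {η : ℕ → ℝ} (hη : Tendsto η atTop (𝓝 0))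
    (h : ∀ n, ∃ s t : unitInterval, s ≤ t ∧ ∃ x ∈ A, ∃ y ∈ B,
      dist (γ s) x ≤ η n ∧ dist (γ t) y ≤ η n) :
    ∃ s t : unitInterval, s ≤ t ∧ γ s ∈ A ∧ γ t ∈ B := by
  choose s t hst x hx y hy hsx hty using h
  obtain ⟨⟨s₀, t₀⟩, ψ, hψ, hlim⟩ := CompactSpace.tendsto_subseq fun n => (s n, t n)
  have hs : Tendsto (fun k => s (ψ k)) atTop (𝓝 s₀) := (continuous_fst.tendsto _).comp hlim
  have ht : Tendsto (fun k => t (ψ k)) atTop (𝓝 t₀) := (continuous_snd.tendsto _).comp hlim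
  have hηψ : Tendsto (fun k => η (ψ k)) atTop (𝓝 0) := hη.comp hψ.tendsto_atTop
  -- limits of approximate visits of a closed set are visits
  have key : ∀ {C : Set E}, IsClosed C → ∀ {u : ℕ → unitInterval} {u₀ : unitInterval} {z : ℕ → E},
      Tendsto (fun k => u (ψ k)) atTop (𝓝 u₀) → (∀ n, z n ∈ C) →
        (∀ n, dist (γ (u n)) (z n) ≤ η n) → γ u₀ ∈ C :=
    fun hC u u₀ z hu hz hdz => hC.mem_of_tendsto ((((γ.continuous.tendsto _).comp hu).congr_dist
      (squeeze_zero (fun _ => dist_nonneg) (fun k => hdz (ψ k)) hηψ)))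
        (Eventually.of_forall fun k => hz (ψ k))
  exact ⟨s₀, t₀, le_of_tendsto_of_tendsto hs ht (Eventually.of_forall fun k => hst (ψ k)),
    key hA hs hx hsx, key hB ht hy hty⟩

/-- **`visitsThen A B` is closed for closed `A`, `B`** (it is sequentially closed). -/
theorem isClosed_visitsThen {A B : Set E} (hA : IsClosed A) (hB : IsClosed B) :
    IsClosed (CurveClass.mk '' {γ : Curve E | ∃ s t : unitInterval, s ≤ t ∧ γ s ∈ A ∧ γ t ∈ B}) := by
  refine isSeqClosed_iff_isClosed.1 fun c c₀ hc hlim => ?_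
  obtain ⟨γ, rfl⟩ := CurveClass.surjective_mk c₀
  choose γs hγs hmk using hc
  have hd : Tendsto (fun n => dist γ (γs n)) atTop (𝓝 0) := by
    refine (tendsto_iff_dist_tendsto_zero.1 hlim).congr fun n => ?_
    rw [← hmk n, CurveClass.dist_mk_mk, dist_comm]
  refine ⟨γ, exists_le_mem_of_forall_near hA hB
    (η := fun n => dist γ (γs n) + 1 / ((n : ℝ) + 1)) ?_ fun n =>
      exists_near_of_dist_lt (hγs n) (lt_add_of_pos_right _ Nat.one_div_pos_of_nat), rfl⟩
  simpa using hd.add tendsto_one_div_add_atTop_nhds_zero_nat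

/-- **Membership in `visitsThen A B` does not depend on the representative** (closed `A`, `B`):
the class of `γ` lies in the event iff `γ` itself visits `A` and then `B`. -/
theorem mk_mem_visitsThen_iff {A B : Set E} (hA : IsClosed A) (hB : IsClosed B) {γ : Curve E} :
    CurveClass.mk γ ∈ CurveClass.mk '' {γ : Curve E | ∃ s t : unitInterval, s ≤ t ∧ γ s ∈ A ∧ γ t ∈ B} ↔
      ∃ s t : unitInterval, s ≤ t ∧ γ s ∈ A ∧ γ t ∈ B := by
  refine ⟨?_, fun h => ⟨γ, h, rfl⟩⟩
  rintro ⟨γ', hγ', hmk⟩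
  exact exists_le_mem_of_forall_near hA hB tendsto_one_div_add_atTop_nhds_zero_nat fun n =>
    exists_near_of_dist_lt hγ' ((dist_comm γ' γ ▸ CurveClass.mk_eq_mk_iff_dist_eq_zero.1
      hmk : dist γ γ' = 0).trans_lt Nat.one_div_pos_of_nat)

/-- The set of points at distance `≥ R'` from `p` is closed. -/
theorem isClosed_setOf_le_dist (p : E) (R' : ℝ) : IsClosed {z : E | R' ≤ dist z p} :=
  isClosed_le continuous_const (continuous_id.dist continuous_const)

/-- **No simple class with source `p` leaves `B(p, R')` and then returns arbitrarily close to
`p`**: `⋂ m, visitsThen {R' ≤ dist · p} (closedBall p (1/(m+1)))` contains no simple class of source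
`p` (a limit pair of times `s ≤ t` has `γ t = p = γ 0`, so `t = 0 = s`, but `R' ≤ dist (γ s) p`). -/
theorem not_mem_iInter_visitsThen_of_source {p : E} {R' : ℝ} (hR' : 0 < R') {c : CurveClass E}
    (hc : c ∈ CurveClass.simple) (hsrc : c.source = p) :
    c ∉ ⋂ m : ℕ, CurveClass.mk '' {γ : Curve E | ∃ s t : unitInterval, s ≤ t ∧
      γ s ∈ {z : E | R' ≤ dist z p} ∧ γ t ∈ closedBall p (1 / ((m : ℝ) + 1))} := by
  obtain ⟨γ, hγ, rfl⟩ := hc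
  intro h
  obtain ⟨s, t, hst, hs, ht⟩ :
      ∃ s t : unitInterval, s ≤ t ∧ γ s ∈ {z : E | R' ≤ dist z p} ∧ γ t ∈ ({p} : Set E) := by
    refine exists_le_mem_of_forall_near (isClosed_setOf_le_dist p R') isClosed_singleton
      tendsto_one_div_add_atTop_nhds_zero_nat fun m => ?_
    obtain ⟨s, t, hst, hs, ht⟩ :=
      (mk_mem_visitsThen_iff (isClosed_setOf_le_dist p R') isClosed_closedBall).1 (mem_iInter.1 h m)
    exact ⟨s, t, hst, γ s, hs, p, rfl, by simp; positivity, mem_closedBall.1 ht⟩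
  change γ 0 = p at hsrc
  have ht0 : t = 0 := hγ ((mem_singleton_iff.1 ht).trans hsrc.symm)
  have hs0 : s = 0 := le_antisymm (ht0 ▸ hst) unitInterval.nonneg'
  exact (not_le.2 hR') (by simpa [hs0, hsrc] using hs)

/-- **No simple class with target `p` comes close to `p` and then leaves `B(p, R')` again**:
`⋂ m, visitsThen (closedBall p (1/(m+1))) {R' ≤ dist · p}` contains no simple class of target `p`
(a limit pair of times `s ≤ t` has `γ s = p = γ 1`, so `s = 1 = t`, but `R' ≤ dist (γ t) p`). -/
theorem not_mem_iInter_visitsThen_of_target {p : E} {R' : ℝ} (hR' : 0 < R') {c : CurveClass E}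
    (hc : c ∈ CurveClass.simple) (htgt : c.target = p) :
    c ∉ ⋂ m : ℕ, CurveClass.mk '' {γ : Curve E | ∃ s t : unitInterval, s ≤ t ∧
      γ s ∈ closedBall p (1 / ((m : ℝ) + 1)) ∧ γ t ∈ {z : E | R' ≤ dist z p}} := by
  obtain ⟨γ, hγ, rfl⟩ := hc
  intro h
  obtain ⟨s, t, hst, hs, ht⟩ :
      ∃ s t : unitInterval, s ≤ t ∧ γ s ∈ ({p} : Set E) ∧ γ t ∈ {z : E | R' ≤ dist z p} := by
    refine exists_le_mem_of_forall_near isClosed_singleton (isClosed_setOf_le_dist p R')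
      tendsto_one_div_add_atTop_nhds_zero_nat fun m => ?_
    obtain ⟨s, t, hst, hs, ht⟩ :=
      (mk_mem_visitsThen_iff isClosed_closedBall (isClosed_setOf_le_dist p R')).1 (mem_iInter.1 h m)
    exact ⟨s, t, hst, p, rfl, γ t, ht, mem_closedBall.1 hs, by simp; positivity⟩
  change γ 1 = p at htgt
  have hs1 : s = 1 := hγ ((mem_singleton_iff.1 hs).trans htgt.symm)
  have ht1 : t = 1 := le_antisymm unitInterval.le_one' (hs1 ▸ hst)
  exact (not_le.2 hR') (by simpa [ht1, htgt] using ht)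

end VisitsThen

/-! ### The lattice side: vertex times of the polyline -/

/-- Two vertices of a polyline with indices `i < j` are visited at times `s ≤ t`
(`exists_vertexTimes_polylineFrom`). -/
theorem polyline_exists_le_apply_eq {L : List ℂ} {i j : ℕ} (hij : i < j) (hj : j < L.length) :
    ∃ s t : unitInterval, s ≤ t ∧ polyline L s = L[i]'(hij.trans hj) ∧ polyline L t = L[j]'hj := by
  cases L with
  | nil => exact absurd hj (Nat.not_lt_zero _)
  | cons a rest =>
    obtain ⟨T, hTmono, hTval⟩ := exists_vertexTimes_polylineFrom a rest
    exact ⟨T i, T j, (hTmono i j hij (by simp only [List.length_cons] at hj; omega)).le,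
      hTval i (hij.trans hj), hTval j hj⟩

/-- A polyline through `l₁ ++ x :: l₂` visits `x` and then (at a later time) every `y ∈ l₂`. -/
theorem polyline_visits_append_cons (l₁ : List ℂ) (x : ℂ) (l₂ : List ℂ) {y : ℂ} (hy : y ∈ l₂) :
    ∃ s t : unitInterval, s ≤ t ∧ polyline (l₁ ++ x :: l₂) s = x ∧
      polyline (l₁ ++ x :: l₂) t = y := by
  obtain ⟨k, hk, rfl⟩ := List.getElem_of_mem hy
  have hj : k + 1 + l₁.length < (l₁ ++ x :: l₂).length := by
    simp only [List.length_append, List.length_cons]; omega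
  obtain ⟨s, t, hst, hs, ht⟩ := polyline_exists_le_apply_eq (L := l₁ ++ x :: l₂)
    (i := 0 + l₁.length) (j := k + 1 + l₁.length) (by omega) hj
  refine ⟨s, t, hst, ?_, ?_⟩
  · rw [hs, ← List.getElem_append_right' l₁ (by simp : 0 < (x :: l₂).length)]
    rfl
  · rw [ht, ← List.getElem_append_right' l₁ (by simpa using hk : k + 1 < (x :: l₂).length)]
    rfl

/-- **The lattice event lies in the curve event**: if the support of a SAW of `Ω_δ` splits as
`l₁ ++ u :: l₂` with `v ∈ l₂` (so `v` is visited after `u`), `δ emb u ∈ A` and `δ emb v ∈ B`,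
then its curve class lies in `visitsThen A B`. -/
theorem curve_mem_visitsThen {V : Type*} {G : SimpleGraph V} {emb : V → ℂ} {Ω : Set ℂ} {δ : ℝ}
    {a b : V} (γ : EmbDomainSAW G emb Ω δ a b) {A B : Set ℂ} {l₁ l₂ : List V} {u v : V}
    (hsupp : γ.walk.support = l₁ ++ u :: l₂) (hv : v ∈ l₂) (hu : (δ : ℂ) * emb u ∈ A)
    (hvB : (δ : ℂ) * emb v ∈ B) :
    γ.curve ∈ CurveClass.mk '' {γ : Curve ℂ | ∃ s t : unitInterval, s ≤ t ∧ γ s ∈ A ∧ γ t ∈ B} := by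
  obtain ⟨s, t, hst, hs, ht⟩ := polyline_visits_append_cons (l₁.map fun w => (δ : ℂ) * emb w)
    ((δ : ℂ) * emb u) (l₂.map fun w => (δ : ℂ) * emb w) (List.mem_map.2 ⟨v, hv, rfl⟩)
  refine ⟨⟨γ.walk.toCurve fun w => (δ : ℂ) * emb w⟩, ⟨s, t, hst, ?_, ?_⟩, rfl⟩
  · change polyline (γ.walk.support.map fun w => (δ : ℂ) * emb w) s ∈ A
    rw [hsupp, List.map_append, List.map_cons, hs]
    exact hu
  · change polyline (γ.walk.support.map fun w => (δ : ℂ) * emb w) t ∈ B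
    rw [hsupp, List.map_append, List.map_cons, ht]
    exact hvB

/-! ### The contradiction scheme: Prokhorov, simplicity of the limit, portmanteau -/

/-- `1/(m'+1) ≤ 1/(m+1)` for `m ≤ m'`. -/
theorem one_div_succ_antitone {m m' : ℕ} (hmm' : m ≤ m') :
    1 / ((m' : ℝ) + 1) ≤ 1 / ((m : ℝ) + 1) :=
  one_div_le_one_div_of_le (by positivity) (by exact_mod_cast Nat.succ_le_succ hmm')

/-- **Asymptotically small lattice events from closed, decreasing, limit-null curve events.**  If
the SAW curves in `(D; a, b)` are tight along the mesh, `F m` are closed decreasing curve events with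
`⋂ m, F m` null for every probability weak limit along a mesh sequence, and the lattice events
`G δ r` increase in `r` with `G δ (1/(m+1)) ⊆ curve ⁻¹' (F m)`, then for every `ε > 0` some `r > 0`
has eventually `P_δ (G δ r) ≤ ε` (violating meshes by `Filter.Frequently`; Prokhorov
`IsTightAlongMesh.exists_subseq` on the Dirac-padded push-forward laws; continuity from above;
portmanteau `ProbabilityMeasure.limsup_measure_closed_le_of_tendsto`). -/
theorem exists_eventually_measure_le_of_antitone {D : DobrushinDomain} {a b : ℝ → HexVertex}
    (hab : IsEmbEndpointApprox hexGraph hexCenter D a b)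
    (hT : IsTightAlongMesh (fun δ (γ : HexDomainSAW D.carrier δ (a δ) (b δ)) => γ.curve)
      (fun δ => hexSAWLaw D.carrier δ (a δ) (b δ)))
    {F : ℕ → Set (CurveClass ℂ)} (hF : ∀ m, IsClosed (F m)) (hanti : Antitone F)
    (hN : ∀ (s : ℕ → ℝ) (μ : Measure (CurveClass ℂ)), Tendsto s atTop (𝓝[>] 0) →
      IsProbabilityMeasure μ →
      (∀ f : CurveClass ℂ →ᵇ ℝ,
        Tendsto (fun n => ∫ γ, f γ.curve ∂(hexSAWLaw D.carrier (s n) (a (s n)) (b (s n)))) atTop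
          (𝓝 (∫ x, f x ∂μ))) → μ (⋂ m, F m) = 0)
    (G : ∀ δ : ℝ, ℝ → Set (HexDomainSAW D.carrier δ (a δ) (b δ)))
    (hmono : ∀ δ r r', r ≤ r' → G δ r ⊆ G δ r')
    (hGF : ∀ (δ : ℝ) (m : ℕ), G δ (1 / ((m : ℝ) + 1)) ⊆
      (fun γ : HexDomainSAW D.carrier δ (a δ) (b δ) => γ.curve) ⁻¹' F m)
    {ε : ℝ} (hε : 0 < ε) :
    ∃ r > (0 : ℝ), ∀ᶠ δ : ℝ in 𝓝[>] 0,
      hexSAWLaw D.carrier δ (a δ) (b δ) (G δ r) ≤ ENNReal.ofReal ε := by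
  by_contra H
  have hfreq : ∀ r : ℝ, 0 < r → ∃ᶠ δ in 𝓝[>] (0 : ℝ), ENNReal.ofReal ε <
      hexSAWLaw D.carrier δ (a δ) (b δ) (G δ r) :=
    fun r hr => (not_eventually.1 fun h => H ⟨r, hr, h⟩).mono fun δ hδ => not_le.1 hδ
  -- meshes `s j ∈ (0, 1/(j+1))` with probability laws and bad mass `> ε` at `r = 1/(j+1)`
  have hchoice : ∀ j : ℕ, ∃ δ : ℝ,
      ENNReal.ofReal ε < hexSAWLaw D.carrier δ (a δ) (b δ) (G δ (1 / ((j : ℝ) + 1))) ∧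
        IsProbabilityMeasure (hexSAWLaw D.carrier δ (a δ) (b δ)) ∧
        δ ∈ Ioo (0 : ℝ) (1 / ((j : ℝ) + 1)) := fun j =>
    ((hfreq _ Nat.one_div_pos_of_nat).and_eventually
      ((eventually_isProbabilityMeasure_hexSAWLaw hab).and
        (Ioo_mem_nhdsGT Nat.one_div_pos_of_nat))).exists
  choose s hs_bad hs_prob hs_mem using hchoice
  have hs0 : Tendsto s atTop (𝓝[>] (0 : ℝ)) := by
    refine tendsto_nhdsWithin_iff.2 ⟨?_, Eventually.of_forall fun j => (hs_mem j).1⟩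
    exact squeeze_zero (fun j => (hs_mem j).1.le) (fun j => (hs_mem j).2.le)
      tendsto_one_div_add_atTop_nhds_zero_nat
  -- the push-forward laws, padded to probability measures (as in `Negative/Identification.lean`)
  have hmeas : ∀ δ, Measurable (fun γ : HexDomainSAW D.carrier δ (a δ) (b δ) => γ.curve) :=
    fun δ => EmbDomainSAW.measurable_of_top _
  let Q : ℝ → Measure (CurveClass ℂ) := fun δ =>
    (hexSAWLaw D.carrier δ (a δ) (b δ)).map fun γ : HexDomainSAW D.carrier δ (a δ) (b δ) => γ.curve
  let c₀ : CurveClass ℂ := CurveClass.mk ⟨ContinuousMap.const _ 0⟩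
  let Q' : ℝ → Measure (CurveClass ℂ) := fun δ =>
    if IsProbabilityMeasure (Q δ) then Q δ else Measure.dirac c₀
  haveI hQ' : ∀ δ, IsProbabilityMeasure (Q' δ) := fun δ => by
    by_cases h : IsProbabilityMeasure (Q δ)
    · simp only [Q', if_pos h]; exact h
    · simp only [Q', if_neg h]; infer_instance
  have hQ'eq : ∀ δ, IsProbabilityMeasure (hexSAWLaw D.carrier δ (a δ) (b δ)) → Q' δ = Q δ := by
    intro δ hδ
    have : IsProbabilityMeasure (Q δ) := Measure.isProbabilityMeasure_map (hmeas δ).aemeasurable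
    simp only [Q', if_pos this]
  have hev : ∀ᶠ δ in 𝓝[>] (0 : ℝ), Q' δ = Q δ :=
    (eventually_isProbabilityMeasure_hexSAWLaw hab).mono hQ'eq
  have hT' : IsTightAlongMesh (fun _ => (id : CurveClass ℂ → CurveClass ℂ)) Q' := by
    intro e he
    obtain ⟨K, hK, hKev⟩ := hT e he
    refine ⟨K, hK, ?_⟩
    filter_upwards [hKev, hev] with δ h1 h2
    rw [h2, Set.preimage_id_eq, id,
      Measure.map_apply (hmeas δ) hK.isClosed.isOpen_compl.measurableSet]
    exact h1
  -- Prokhorov along the mesh sequence `s`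
  obtain ⟨φ, μ, hφ, hμ, hlim⟩ :=
    hT'.exists_subseq (Eventually.of_forall fun δ => aemeasurable_id) hs0
  have hQs : ∀ n, Q' (s (φ n)) = Q (s (φ n)) := fun n => hQ'eq _ (hs_prob (φ n))
  have hint : ∀ n (f : CurveClass ℂ →ᵇ ℝ), ∫ x, f x ∂Q' (s (φ n)) =
      ∫ ω, f ω.curve ∂hexSAWLaw D.carrier (s (φ n)) (a (s (φ n))) (b (s (φ n))) := by
    intro n f
    rw [hQs n]
    exact integral_map (hmeas _).aemeasurable f.continuous.aestronglyMeasurable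
  -- the limit does not charge `⋂ m, F m` (hypothesis `hN`), hence charges some `F m` by `< ε`
  have hnull : μ (⋂ m, F m) = 0 :=
    hN (s ∘ φ) μ (hs0.comp hφ.tendsto_atTop) hμ fun f => (hlim f).congr fun n => hint n f
  haveI := hμ
  have htends : Tendsto (fun m => μ (F m)) atTop (𝓝 (μ (⋂ m, F m))) :=
    tendsto_measure_iInter_atTop (fun m => (hF m).measurableSet.nullMeasurableSet) hanti
      ⟨0, measure_ne_top μ _⟩
  rw [hnull] at htends
  obtain ⟨m, hm⟩ := (htends.eventually (gt_mem_nhds (ENNReal.ofReal_pos.2 hε))).exists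
  -- portmanteau for the closed set `F m`
  let ν : ℕ → ProbabilityMeasure (CurveClass ℂ) := fun n => ⟨Q' (s (φ n)), hQ' _⟩
  have hconv : Tendsto ν atTop (𝓝 (⟨μ, hμ⟩ : ProbabilityMeasure (CurveClass ℂ))) :=
    ProbabilityMeasure.tendsto_iff_forall_integral_tendsto.2 hlim
  have hlimsup := ProbabilityMeasure.limsup_measure_closed_le_of_tendsto hconv (hF m)
  have hevF : ∀ᶠ n in atTop, (ν n : Measure (CurveClass ℂ)) (F m) < ENNReal.ofReal ε :=
    eventually_lt_of_limsup_lt (hlimsup.trans_lt hm)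
  have hevm : ∀ᶠ n in atTop, 1 / ((φ n : ℝ) + 1) ≤ 1 / ((m : ℝ) + 1) :=
    (hφ.tendsto_atTop.eventually (eventually_ge_atTop m)).mono fun n => one_div_succ_antitone
  obtain ⟨n, hnF, hnm⟩ := (hevF.and hevm).exists
  have key : ENNReal.ofReal ε < Q' (s (φ n)) (F m) :=
    calc ENNReal.ofReal ε
        < hexSAWLaw D.carrier (s (φ n)) (a (s (φ n))) (b (s (φ n)))
            (G (s (φ n)) (1 / ((φ n : ℝ) + 1))) := hs_bad (φ n)
      _ ≤ hexSAWLaw D.carrier (s (φ n)) (a (s (φ n))) (b (s (φ n)))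
            ((fun γ : HexDomainSAW D.carrier (s (φ n)) (a (s (φ n))) (b (s (φ n))) => γ.curve) ⁻¹'
              F m) := measure_mono ((hmono _ _ _ hnm).trans (hGF _ m))
      _ = Q (s (φ n)) (F m) := (Measure.map_apply (hmeas _) (hF m).measurableSet).symm
      _ = Q' (s (φ n)) (F m) := by rw [hQs n]
  exact lt_irrefl _ (key.trans hnF)

/-! ### The stub -/

/-- **STUB NB of the line `six-class-type-ladder` (r14) — NO MACROSCOPIC BACKTRACKING from TIGHTNESS
and SIMPLICITY OF ALL SUBSEQUENTIAL LIMITS** (`HexTight → HexSimpleSubseqLimits →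
NoMacroBacktracking`, all inlined): the source and the target event are bounded separately by
`exists_eventually_measure_le_of_antitone` through the closed decreasing curve events
`visitsThen {R' ≤ dist · (pt 0)} (closedBall (pt 0) (1/(m+1)))` resp.
`visitsThen (closedBall (pt 1) (1/(m+1))) {R' ≤ dist · (pt 1)}`, and `r := min r₁ r₂`. -/
theorem stub_noMacroBacktracking :
    (∀ (D : DobrushinDomain) (a b : ℝ → HexVertex), IsEmbEndpointApprox hexGraph hexCenter D a b →
      IsTightAlongMesh (fun δ (γ : HexDomainSAW D.carrier δ (a δ) (b δ)) => γ.curve)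
        (fun δ => hexSAWLaw D.carrier δ (a δ) (b δ))) →
    (∀ (D : DobrushinDomain) (a b : ℝ → HexVertex), IsEmbEndpointApprox hexGraph hexCenter D a b →
      ∀ (s : ℕ → ℝ) (ν : Measure (CurveClass ℂ)), Tendsto s atTop (𝓝[>] 0) → IsProbabilityMeasure ν →
        (∀ f : CurveClass ℂ →ᵇ ℝ,
          Tendsto (fun n => ∫ γ, f γ.curve ∂(hexSAWLaw D.carrier (s n) (a (s n)) (b (s n)))) atTop
            (𝓝 (∫ x, f x ∂ν))) →
        ∀ᵐ γ ∂ν, γ ∈ CurveClass.simple ∧ γ.source = D.pt 0 ∧ γ.target = D.pt 1 ∧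
          γ.range ⊆ closure D.carrier ∧ γ.range ∩ frontier D.carrier ⊆ {D.pt 0, D.pt 1}) →
    ∀ (D : DobrushinDomain) (a b : ℝ → HexVertex), IsEmbEndpointApprox hexGraph hexCenter D a b →
      ∀ R' > (0 : ℝ), ∀ ε > (0 : ℝ), ∃ r > (0 : ℝ), ∀ᶠ δ : ℝ in 𝓝[>] 0,
        hexSAWLaw D.carrier δ (a δ) (b δ)
            {γ | ∃ (l₁ l₂ : List HexVertex) (u v : HexVertex), γ.walk.support = l₁ ++ u :: l₂ ∧ v ∈ l₂ ∧
              R' ≤ dist ((δ : ℂ) * hexCenter u) (D.pt 0) ∧ dist ((δ : ℂ) * hexCenter v) (D.pt 0) ≤ r} ≤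
          ENNReal.ofReal ε ∧
        hexSAWLaw D.carrier δ (a δ) (b δ)
            {γ | ∃ (l₁ l₂ : List HexVertex) (u v : HexVertex), γ.walk.support = l₁ ++ u :: l₂ ∧ v ∈ l₂ ∧
              dist ((δ : ℂ) * hexCenter u) (D.pt 1) ≤ r ∧ R' ≤ dist ((δ : ℂ) * hexCenter v) (D.pt 1)} ≤
          ENNReal.ofReal ε := by
  intro hT hS D a b hab R' hR' ε hε
  -- the source event
  obtain ⟨r₁, hr₁, hev₁⟩ := exists_eventually_measure_le_of_antitone hab (hT D a b hab)
    (F := fun m => CurveClass.mk '' {γ : Curve ℂ | ∃ s t : unitInterval, s ≤ t ∧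
      γ s ∈ {z : ℂ | R' ≤ dist z (D.pt 0)} ∧ γ t ∈ closedBall (D.pt 0) (1 / ((m : ℝ) + 1))})
    (fun m => isClosed_visitsThen (isClosed_setOf_le_dist _ _) isClosed_closedBall)
    (fun m m' hmm' => Set.image_mono fun γ => by
      rintro ⟨s, t, hst, hs, ht⟩
      exact ⟨s, t, hst, hs, closedBall_subset_closedBall (one_div_succ_antitone hmm') ht⟩)
    (fun s μ hs hμ hl => by
      refine measure_mono_null ?_ (ae_iff.1 (hS D a b hab s μ hs hμ hl))
      intro c hc hgood
      exact not_mem_iInter_visitsThen_of_source hR' hgood.1 hgood.2.1 hc)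
    (fun δ r => {γ | ∃ (l₁ l₂ : List HexVertex) (u v : HexVertex),
      γ.walk.support = l₁ ++ u :: l₂ ∧ v ∈ l₂ ∧
        R' ≤ dist ((δ : ℂ) * hexCenter u) (D.pt 0) ∧ dist ((δ : ℂ) * hexCenter v) (D.pt 0) ≤ r})
    (fun δ r r' hrr' γ => by
      rintro ⟨l₁, l₂, u, v, h1, h2, h3, h4⟩
      exact ⟨l₁, l₂, u, v, h1, h2, h3, h4.trans hrr'⟩)
    (fun δ m γ => by
      rintro ⟨l₁, l₂, u, v, h1, h2, h3, h4⟩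
      exact curve_mem_visitsThen γ h1 h2 h3 (mem_closedBall.2 h4))
    hε
  -- the target event
  obtain ⟨r₂, hr₂, hev₂⟩ := exists_eventually_measure_le_of_antitone hab (hT D a b hab)
    (F := fun m => CurveClass.mk '' {γ : Curve ℂ | ∃ s t : unitInterval, s ≤ t ∧
      γ s ∈ closedBall (D.pt 1) (1 / ((m : ℝ) + 1)) ∧ γ t ∈ {z : ℂ | R' ≤ dist z (D.pt 1)}})
    (fun m => isClosed_visitsThen isClosed_closedBall (isClosed_setOf_le_dist _ _))
    (fun m m' hmm' => Set.image_mono fun γ => by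
      rintro ⟨s, t, hst, hs, ht⟩
      exact ⟨s, t, hst, closedBall_subset_closedBall (one_div_succ_antitone hmm') hs, ht⟩)
    (fun s μ hs hμ hl => by
      refine measure_mono_null ?_ (ae_iff.1 (hS D a b hab s μ hs hμ hl))
      intro c hc hgood
      exact not_mem_iInter_visitsThen_of_target hR' hgood.1 hgood.2.2.1 hc)
    (fun δ r => {γ | ∃ (l₁ l₂ : List HexVertex) (u v : HexVertex),
      γ.walk.support = l₁ ++ u :: l₂ ∧ v ∈ l₂ ∧
        dist ((δ : ℂ) * hexCenter u) (D.pt 1) ≤ r ∧ R' ≤ dist ((δ : ℂ) * hexCenter v) (D.pt 1)})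
    (fun δ r r' hrr' γ => by
      rintro ⟨l₁, l₂, u, v, h1, h2, h3, h4⟩
      exact ⟨l₁, l₂, u, v, h1, h2, h3.trans hrr', h4⟩)
    (fun δ m γ => by
      rintro ⟨l₁, l₂, u, v, h1, h2, h3, h4⟩
      exact curve_mem_visitsThen γ h1 h2 (mem_closedBall.2 h3) h4)
    hε
  refine ⟨min r₁ r₂, lt_min hr₁ hr₂, ?_⟩
  filter_upwards [hev₁, hev₂] with δ h₁ h₂
  refine ⟨(measure_mono ?_).trans h₁, (measure_mono ?_).trans h₂⟩
  · rintro γ ⟨l₁, l₂, u, v, h1, h2, h3, h4⟩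
    exact ⟨l₁, l₂, u, v, h1, h2, h3, h4.trans (min_le_left _ _)⟩
  · rintro γ ⟨l₁, l₂, u, v, h1, h2, h3, h4⟩
    exact ⟨l₁, l₂, u, v, h1, h2, h3.trans (min_le_right _ _), h4⟩

end Summit.CriticalPhenomena.SAWScalingLimit.Theorems.ObservableToSLE.TypeLadder

end
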